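import Literature.Analysis.FluidPDE.DuchonRobertPressure
import Literature.Analysis.FluidPDE.NSUniqueness2DProofs
import Literature.Analysis.FunctionSpaces.TorusEnstrophyOrthogonality
import Literature.Analysis.FunctionSpaces.TorusConvolution
import Literature.Analysis.FunctionSpaces.TorusInverseLaplacianCalculus
import HarnessLib

/-!
# The perpendicular gradient `∇^⊥φ = -∂₁φ e₀ + ∂₀φ e₁` of a scalar space–time test function on `T²`

Analysis/FluidPDE proof-support file (theorem-only, everything proved). In two space dimensions
the divergence-free test fields of the Leray–Hopf weak formulation that see the VORTICITY are the
perpendicular gradients `ψ = ∇^⊥φ` of scalar tests `φ`: testing `∂ₜv + (v·∇)v + ∇p = νΔv + g`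
against `∇^⊥φ` and integrating by parts gives the weak vorticity equation
`∂ₜω + v·∇ω = νΔω + curl g`, `ω = curl v = ∂₀v₁ - ∂₁v₀` (Majda–Bertozzi 2002, §2.1, the
vorticity-stream formulation, and Prop. 2.7; Kuksin–Shirikyan 2012, §2.1). This file provides the
calculus of `∇^⊥φ` in the tree's torus vocabulary, written as
`fun t x => (-∂₁(φ t) x) • e₀ + (∂₀(φ t) x) • e₁` with `eᵢ = EuclideanSpace.single i 1`:

* `PerpGrad.isSpaceTimeTest`, `PerpGrad.isDivFreeTest` — `∇^⊥φ` is a divergence-free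
  space–time test field when `φ` is a scalar space–time test function;
* `PerpGrad.timeDeriv_eq`, `PerpGrad.laplacian_eq` — `∂ₜ∇^⊥φ = ∇^⊥∂ₜφ`, `Δ∇^⊥χ = ∇^⊥Δχ`
  (Schwarz: `Torus.timeDeriv_partialDeriv_comm`, `Torus.partialDeriv_laplacian`);
* `PerpGrad.integral_inner_smooth` — `∫⟪G, ∇^⊥χ⟫ = -∫ χ curl G` for smooth `G`
  (integration by parts on `T²`);
* small integrability lemmas for slice pairings of `L²` fields with smooth multipliers.

## References

* A. J. Majda, A. L. Bertozzi, *Vorticity and Incompressible Flow*, CUP 2002, §2.1, Prop. 2.7.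
* S. Kuksin, A. Shirikyan, *Mathematics of Two-Dimensional Turbulence*, CUP 2012, §2.1.
-/

noncomputable section

open MeasureTheory Filter Topology Set Function
open scoped ENNReal NNReal

namespace Literature.Analysis.FluidPDE.Torus.PerpGrad

open Literature.Analysis.FunctionSpaces

/-- Pairing a planar vector with `p e₀ + q e₁`. [folklore] -/
theorem inner_smul_e_add (a : EuclideanSpace ℝ (Fin 2)) (p q : ℝ) :
    inner ℝ a (p • EuclideanSpace.single (0 : Fin 2) (1 : ℝ) + q • EuclideanSpace.single (1 : Fin 2) (1 : ℝ)) =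
      a 0 * p + a 1 * q := by
  simp [inner_add_right, inner_smul_right, EuclideanSpace.inner_single_right, mul_comm]

/-- First component of `p e₀ + q e₁`. [folklore] -/
theorem smul_e_add_apply_zero (p q : ℝ) :
    (p • EuclideanSpace.single (0 : Fin 2) (1 : ℝ) + q • EuclideanSpace.single (1 : Fin 2) (1 : ℝ)) 0 = p := by
  simp

/-- Second component of `p e₀ + q e₁`. [folklore] -/
theorem smul_e_add_apply_one (p q : ℝ) :
    (p • EuclideanSpace.single (0 : Fin 2) (1 : ℝ) + q • EuclideanSpace.single (1 : Fin 2) (1 : ℝ)) 1 = q := by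
  simp

/-- `∇^⊥χ` is smooth for smooth `χ`. [folklore] -/
theorem isSmooth {χ : UnitAddTorus (Fin 2) → ℝ} (hχ : Torus.IsSmooth χ) :
    Torus.IsSmooth (fun x => (-Torus.partialDeriv 1 χ x) • EuclideanSpace.single (0 : Fin 2) (1 : ℝ) +
      Torus.partialDeriv 0 χ x • EuclideanSpace.single (1 : Fin 2) (1 : ℝ)) :=
  ((hχ.partialDeriv 1).neg.smul_const _).add ((hχ.partialDeriv 0).smul_const _)

/-- `∇^⊥χ` is divergence free for smooth `χ` (Schwarz, `Torus.partialDeriv_comm`). [folklore] -/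
theorem isDivFree {χ : UnitAddTorus (Fin 2) → ℝ} (hχ : Torus.IsSmooth χ) :
    Torus.IsDivFree (fun x => (-Torus.partialDeriv 1 χ x) • EuclideanSpace.single (0 : Fin 2) (1 : ℝ) +
      Torus.partialDeriv 0 χ x • EuclideanSpace.single (1 : Fin 2) (1 : ℝ)) := by
  intro x
  have e0 : (fun y => ((-Torus.partialDeriv 1 χ y) • EuclideanSpace.single (0 : Fin 2) (1 : ℝ) +
      Torus.partialDeriv 0 χ y • EuclideanSpace.single (1 : Fin 2) (1 : ℝ)) 0) =
      fun y => -Torus.partialDeriv 1 χ y := funext fun y => smul_e_add_apply_zero _ _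
  have e1 : (fun y => ((-Torus.partialDeriv 1 χ y) • EuclideanSpace.single (0 : Fin 2) (1 : ℝ) +
      Torus.partialDeriv 0 χ y • EuclideanSpace.single (1 : Fin 2) (1 : ℝ)) 1) =
      Torus.partialDeriv 0 χ := funext fun y => smul_e_add_apply_one _ _
  rw [Torus.divergence, Fin.sum_univ_two, e0, e1, Torus.partialDeriv_neg, Torus.partialDeriv_comm hχ 0 1 x,
    neg_add_cancel]

variable {T : ℝ} {φ : ℝ → UnitAddTorus (Fin 2) → ℝ}

/-- `∇^⊥φ` has smooth space–time lift when `φ` has. [folklore] -/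
theorem contDiff_stLift (hφ : ContDiff ℝ ((⊤ : ℕ∞) : WithTop ℕ∞) (Torus.stLift φ)) :
    ContDiff ℝ ((⊤ : ℕ∞) : WithTop ℕ∞) (Torus.stLift fun t x =>
      (-Torus.partialDeriv 1 (φ t) x) • EuclideanSpace.single (0 : Fin 2) (1 : ℝ) +
        Torus.partialDeriv 0 (φ t) x • EuclideanSpace.single (1 : Fin 2) (1 : ℝ)) :=
  ((Torus.contDiff_stLift_partialDeriv hφ (1 : Fin 2)).neg.smul contDiff_const).add
    ((Torus.contDiff_stLift_partialDeriv hφ (0 : Fin 2)).smul contDiff_const)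

/-- `∇^⊥φ` is a space–time test field when `φ` is. [folklore] -/
theorem isSpaceTimeTest (hφ : Torus.IsSpaceTimeTest T φ) :
    Torus.IsSpaceTimeTest T (fun t x =>
      (-Torus.partialDeriv 1 (φ t) x) • EuclideanSpace.single (0 : Fin 2) (1 : ℝ) +
        Torus.partialDeriv 0 (φ t) x • EuclideanSpace.single (1 : Fin 2) (1 : ℝ)) := by
  obtain ⟨hs, T', hT', h0⟩ := hφ
  refine ⟨contDiff_stLift hs, T', hT', fun t ht => ?_⟩
  funext x
  have hz : φ t = fun _ => (0 : ℝ) := by rw [h0 t ht]; rfl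
  show (-Torus.partialDeriv 1 (φ t) x) • EuclideanSpace.single (0 : Fin 2) (1 : ℝ) +
      Torus.partialDeriv 0 (φ t) x • EuclideanSpace.single (1 : Fin 2) (1 : ℝ) = 0
  have d : ∀ i : Fin 2, Torus.partialDeriv i (φ t) x = 0 := fun i => by
    rw [hz]; simp [Torus.partialDeriv, Torus.lineDeriv]
  rw [d 1, d 0, neg_zero, zero_smul, zero_smul, add_zero]

/-- `∇^⊥φ` is divergence free slice by slice (Schwarz). [folklore] -/
theorem isDivFreeTest (hφ : Torus.IsSpaceTimeTest T φ) :
    Torus.IsDivFreeTest (fun t x =>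
      (-Torus.partialDeriv 1 (φ t) x) • EuclideanSpace.single (0 : Fin 2) (1 : ℝ) +
        Torus.partialDeriv 0 (φ t) x • EuclideanSpace.single (1 : Fin 2) (1 : ℝ)) := fun t =>
  isDivFree (hφ.isSmooth_slice t)

/-- Time derivative of `∇^⊥φ`: `∂ₜ∇^⊥φ = ∇^⊥∂ₜφ` (Schwarz in space–time,
`Torus.timeDeriv_partialDeriv_comm`). [folklore] -/
theorem timeDeriv_eq (hφ : ContDiff ℝ ((⊤ : ℕ∞) : WithTop ℕ∞) (Torus.stLift φ)) (t : ℝ) (x : UnitAddTorus (Fin 2)) :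
    Torus.timeDeriv (fun t x =>
      (-Torus.partialDeriv 1 (φ t) x) • EuclideanSpace.single (0 : Fin 2) (1 : ℝ) +
        Torus.partialDeriv 0 (φ t) x • EuclideanSpace.single (1 : Fin 2) (1 : ℝ)) t x =
      (-Torus.partialDeriv 1 (Torus.timeDeriv φ t) x) • EuclideanSpace.single (0 : Fin 2) (1 : ℝ) +
        Torus.partialDeriv 0 (Torus.timeDeriv φ t) x • EuclideanSpace.single (1 : Fin 2) (1 : ℝ) := by
  have hd : ∀ i : Fin 2, DifferentiableAt ℝ (fun s => Torus.partialDeriv i (φ s) x) t := fun i =>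
    Torus.differentiableAt_time_slice (Torus.contDiff_stLift_partialDeriv hφ i) t x
  have hc : ∀ i : Fin 2, deriv (fun s => Torus.partialDeriv i (φ s) x) t =
      Torus.partialDeriv i (Torus.timeDeriv φ t) x := fun i => Torus.timeDeriv_partialDeriv_comm hφ i t x
  have hd1 : DifferentiableAt ℝ (fun s => -Torus.partialDeriv 1 (φ s) x) t := (hd 1).neg
  show deriv (fun τ => (-Torus.partialDeriv 1 (φ τ) x) • EuclideanSpace.single (0 : Fin 2) (1 : ℝ) +
        Torus.partialDeriv 0 (φ τ) x • EuclideanSpace.single (1 : Fin 2) (1 : ℝ)) t = _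
  rw [deriv_fun_add (hd1.smul_const _) ((hd 0).smul_const _), deriv_smul_const hd1, deriv_smul_const (hd 0),
    hc 0]
  congr 2
  rw [← hc 1]
  exact deriv.fun_neg

/-- `Δ(a • c) = (Δa) • c` for a smooth scalar `a` and a constant vector `c`. [folklore] -/
theorem laplacian_smul_const_apply {a : UnitAddTorus (Fin 2) → ℝ} (ha : Torus.IsSmooth a)
    (c : EuclideanSpace ℝ (Fin 2)) (x : UnitAddTorus (Fin 2)) :
    Torus.laplacian (fun x => a x • c) x = Torus.laplacian a x • c := by
  have h := Torus.laplacian_clm_comp_apply ha ((ContinuousLinearMap.id ℝ ℝ).smulRight c) x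
  rw [show (fun x => a x • c) = ((ContinuousLinearMap.id ℝ ℝ).smulRight c) ∘ a from rfl, h]
  rfl

/-- Laplacian of `∇^⊥χ`: `Δ∇^⊥χ = ∇^⊥Δχ` (`Torus.partialDeriv_laplacian`). [folklore] -/
theorem laplacian_eq {χ : UnitAddTorus (Fin 2) → ℝ} (hχ : Torus.IsSmooth χ) (x : UnitAddTorus (Fin 2)) :
    Torus.laplacian (fun x =>
      (-Torus.partialDeriv 1 χ x) • EuclideanSpace.single (0 : Fin 2) (1 : ℝ) +
        Torus.partialDeriv 0 χ x • EuclideanSpace.single (1 : Fin 2) (1 : ℝ)) x =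
      (-Torus.partialDeriv 1 (Torus.laplacian χ) x) • EuclideanSpace.single (0 : Fin 2) (1 : ℝ) +
        Torus.partialDeriv 0 (Torus.laplacian χ) x • EuclideanSpace.single (1 : Fin 2) (1 : ℝ) := by
  have h1 : Torus.IsSmooth (fun x => -Torus.partialDeriv 1 χ x) := (hχ.partialDeriv 1).neg
  have h0 : Torus.IsSmooth (Torus.partialDeriv 0 χ) := hχ.partialDeriv 0
  have hA : Torus.IsSmooth (fun x => (-Torus.partialDeriv 1 χ x) • EuclideanSpace.single (0 : Fin 2) (1 : ℝ)) :=
    h1.smul_const _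
  have hB : Torus.IsSmooth (fun x => Torus.partialDeriv 0 χ x • EuclideanSpace.single (1 : Fin 2) (1 : ℝ)) :=
    h0.smul_const _
  rw [show (fun x => (-Torus.partialDeriv 1 χ x) • EuclideanSpace.single (0 : Fin 2) (1 : ℝ) +
      Torus.partialDeriv 0 χ x • EuclideanSpace.single (1 : Fin 2) (1 : ℝ)) =
      (fun x => (-Torus.partialDeriv 1 χ x) • EuclideanSpace.single (0 : Fin 2) (1 : ℝ)) +
        fun x => Torus.partialDeriv 0 χ x • EuclideanSpace.single (1 : Fin 2) (1 : ℝ) from rfl,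
    Torus.laplacian_add_apply hA hB x, laplacian_smul_const_apply h1, laplacian_smul_const_apply h0,
    Torus.partialDeriv_laplacian hχ 0 x]
  congr 2
  rw [show (fun x => -Torus.partialDeriv 1 χ x) = -Torus.partialDeriv 1 χ from rfl,
    Torus.laplacian_neg_apply (hχ.partialDeriv 1), Torus.partialDeriv_laplacian hχ 1 x]

/-- Integration by parts against `∇^⊥χ` for a SMOOTH planar field `G`:
`∫⟪G, ∇^⊥χ⟫ = -∫ χ · curl G`, `curl G = ∂₀G₁ - ∂₁G₀`. [folklore] -/
theorem integral_inner_smooth {G : UnitAddTorus (Fin 2) → EuclideanSpace ℝ (Fin 2)}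
    (hG : Torus.IsSmooth G) {χ : UnitAddTorus (Fin 2) → ℝ} (hχ : Torus.IsSmooth χ) :
    ∫ x, inner ℝ (G x) ((-Torus.partialDeriv 1 χ x) • EuclideanSpace.single (0 : Fin 2) (1 : ℝ) +
        Torus.partialDeriv 0 χ x • EuclideanSpace.single (1 : Fin 2) (1 : ℝ)) =
      -∫ x, χ x * (Torus.partialDeriv 0 G x 1 - Torus.partialDeriv 1 G x 0) := by
  -- integration by parts componentwise
  have hw : ∀ i j : Fin 2, ∫ x, Torus.partialDeriv i χ x * G x j = -∫ x, χ x * Torus.partialDeriv i G x j := by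
    intro i j
    have h := (hG.hasWeakPartialDeriv Torus.integral_partialDeriv_eq_zero_holds i) χ hχ
    have hi1 : Integrable (fun x => Torus.partialDeriv i χ x • G x) volume :=
      ((hχ.partialDeriv i).smul' hG).integrable
    have hi2 : Integrable (fun x => χ x • Torus.partialDeriv i G x) volume :=
      (hχ.smul' (hG.partialDeriv i)).integrable
    have e1 := (EuclideanSpace.proj (j : Fin 2) : EuclideanSpace ℝ (Fin 2) →L[ℝ] ℝ).integral_comp_comm hi1
    have e2 := (EuclideanSpace.proj (j : Fin 2) : EuclideanSpace ℝ (Fin 2) →L[ℝ] ℝ).integral_comp_comm hi2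
    have e1' : ∫ x, Torus.partialDeriv i χ x * G x j = (∫ x, Torus.partialDeriv i χ x • G x) j := by
      rw [show (∫ x, Torus.partialDeriv i χ x • G x) j =
        (EuclideanSpace.proj (j : Fin 2) : EuclideanSpace ℝ (Fin 2) →L[ℝ] ℝ) (∫ x, Torus.partialDeriv i χ x • G x)
        from rfl, ← e1]
      rfl
    have e2' : ∫ x, χ x * Torus.partialDeriv i G x j = (∫ x, χ x • Torus.partialDeriv i G x) j := by
      rw [show (∫ x, χ x • Torus.partialDeriv i G x) j =
        (EuclideanSpace.proj (j : Fin 2) : EuclideanSpace ℝ (Fin 2) →L[ℝ] ℝ) (∫ x, χ x • Torus.partialDeriv i G x)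
        from rfl, ← e2]
      rfl
    rw [e1', e2', h]
    rfl
  have hiA : Integrable (fun x => Torus.partialDeriv 0 χ x * G x 1) volume :=
    ((hχ.partialDeriv 0).smul' (hG.apply 1)).integrable
  have hiB : Integrable (fun x => Torus.partialDeriv 1 χ x * G x 0) volume :=
    ((hχ.partialDeriv 1).smul' (hG.apply 0)).integrable
  have hiC : Integrable (fun x => χ x * Torus.partialDeriv 0 G x 1) volume :=
    (hχ.smul' ((hG.partialDeriv 0).apply 1)).integrable
  have hiD : Integrable (fun x => χ x * Torus.partialDeriv 1 G x 0) volume :=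
    (hχ.smul' ((hG.partialDeriv 1).apply 0)).integrable
  calc ∫ x, inner ℝ (G x) ((-Torus.partialDeriv 1 χ x) • EuclideanSpace.single (0 : Fin 2) (1 : ℝ) +
        Torus.partialDeriv 0 χ x • EuclideanSpace.single (1 : Fin 2) (1 : ℝ))
      = ∫ x, (Torus.partialDeriv 0 χ x * G x 1 - Torus.partialDeriv 1 χ x * G x 0) := by
        refine integral_congr_ae (ae_of_all _ fun x => ?_)
        beta_reduce
        rw [inner_smul_e_add]
        ring
    _ = -∫ x, χ x * (Torus.partialDeriv 0 G x 1 - Torus.partialDeriv 1 G x 0) := by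
        rw [integral_sub hiA hiB, hw 0 1, hw 1 0]
        have e : (fun x => χ x * (Torus.partialDeriv 0 G x 1 - Torus.partialDeriv 1 G x 0)) =
            fun x => χ x * Torus.partialDeriv 0 G x 1 - χ x * Torus.partialDeriv 1 G x 0 := by
          funext x; ring
        rw [e, integral_sub hiC hiD]
        ring


/-! ## Integrability of slice pairings -/

/-- Components of an `L²` planar field are integrable. [folklore] -/
theorem integrable_apply_of_memLp {w : UnitAddTorus (Fin 2) → EuclideanSpace ℝ (Fin 2)}
    (hw : MemLp w 2 volume) (j : Fin 2) : Integrable (fun x => w x j) volume :=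
  (EuclideanSpace.proj j : EuclideanSpace ℝ (Fin 2) →L[ℝ] ℝ).integrable_comp (hw.integrable one_le_two)

/-- A continuous function times an integrable one is integrable on `T²`. [folklore] -/
theorem integrable_continuous_mul {b f : UnitAddTorus (Fin 2) → ℝ} (hb : Continuous b)
    (hf : Integrable f volume) : Integrable (fun x => b x * f x) volume := by
  obtain ⟨K, hK⟩ := Torus.exists_forall_norm_le_of_continuous hb
  exact hf.bdd_mul hb.aestronglyMeasurable (ae_of_all _ hK)

/-- `ω ⟪w, G⟫` is integrable for `ω, w ∈ L²` and continuous `G`. [folklore] -/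
theorem integrable_mul_inner {w G : UnitAddTorus (Fin 2) → EuclideanSpace ℝ (Fin 2)} {ω : UnitAddTorus (Fin 2) → ℝ}
    (hω : MemLp ω 2 volume) (hw : MemLp w 2 volume) (hG : Continuous G) :
    Integrable (fun x => ω x * inner ℝ (w x) (G x)) volume := by
  obtain ⟨K, hK⟩ := Torus.exists_forall_norm_le_of_continuous hG
  have hm : AEStronglyMeasurable (fun x => ω x * inner ℝ (w x) (G x)) volume :=
    hω.1.mul (hw.1.inner hG.aestronglyMeasurable)
  have hi : Integrable (fun x => K * (ω x ^ 2 + ‖w x‖ ^ 2)) volume :=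
    (hω.integrable_sq.add ((memLp_two_iff_integrable_sq_norm hw.1).1 hw)).const_mul K
  refine hi.mono' hm (ae_of_all _ fun x => ?_)
  have hK0 : 0 ≤ K := (norm_nonneg _).trans (hK x)
  rw [norm_mul, Real.norm_eq_abs]
  calc |ω x| * ‖inner ℝ (w x) (G x)‖ ≤ |ω x| * (‖w x‖ * K) :=
        mul_le_mul_of_nonneg_left ((norm_inner_le_norm _ _).trans
          (mul_le_mul_of_nonneg_left (hK x) (norm_nonneg _))) (abs_nonneg _)
    _ = K * (|ω x| * ‖w x‖) := by ring
    _ ≤ K * (ω x ^ 2 + ‖w x‖ ^ 2) := by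
        refine mul_le_mul_of_nonneg_left ?_ hK0
        nlinarith [sq_nonneg (|ω x| - ‖w x‖), sq_abs (ω x), norm_nonneg (w x), abs_nonneg (ω x)]

/-! ## Bookkeeping in time -/

/-- From `∫⁻ ‖f‖ₑ² ≤ M` to `∫ ‖f‖² ≤ M.toReal` for an `L²` field. [folklore] -/
theorem integral_norm_sq_le_of_lintegral_le {X : Type*} [NormedAddCommGroup X] {f : UnitAddTorus (Fin 2) → X}
    (hf : MemLp f 2 volume) {M : ℝ≥0} (h : ∫⁻ x, ‖f x‖ₑ ^ 2 ≤ M) : ∫ x, ‖f x‖ ^ 2 ≤ (M : ℝ) := by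
  have hi : Integrable (fun x => ‖f x‖ ^ 2) volume := (memLp_two_iff_integrable_sq_norm hf.1).1 hf
  have e : ENNReal.ofReal (∫ x, ‖f x‖ ^ 2) = ∫⁻ x, ‖f x‖ₑ ^ 2 := by
    rw [ofReal_integral_eq_lintegral_ofReal hi (ae_of_all _ fun x => sq_nonneg _)]
    refine lintegral_congr fun x => ?_
    rw [← ofReal_norm, ENNReal.ofReal_pow (norm_nonneg _)]
  have h' : ENNReal.ofReal (∫ x, ‖f x‖ ^ 2) ≤ M := e ▸ h
  exact (ENNReal.ofReal_le_iff_le_toReal ENNReal.coe_ne_top).1 h'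

end Literature.Analysis.FluidPDE.Torus.PerpGrad

end
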